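import Mathlib.NumberTheory.Cyclotomic.PrimitiveRoots
import Mathlib.FieldTheory.Galois.Abelian
import Mathlib.RingTheory.RootsOfUnity.AlgebraicallyClosed
import Mathlib.FieldTheory.KummerPolynomial
import Mathlib.NumberTheory.Padics.PadicVal.Basic
import HarnessLib

/-!
# An automorphism twisting every element by a root of unity is the identity

Let `Ω` be an algebraically closed field of characteristic `0` and `σ : Ω →+* Ω` a ring
endomorphism such that for every `x ≠ 0` the quotient `σ(x)/x` is a root of unity (i.e.
`σ(x)ⁿ = xⁿ` for some `n ≥ 1`).  Then `σ = id` (`Literature.FieldTheory.Galois.eq_self_of_forall_pow_eq`).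

Proof ("cyclotomic additive trick").  Let `C = ℚ(μ_∞) ⊆ Ω` be the subfield generated by all roots
of unity.  (1) If `x ∉ C` then `σ x = x`: writing `σ x = ζ x`, `σ (1 + x) = ζ' (1 + x)` with roots
of unity `ζ, ζ'`, one gets `(ζ' - ζ) x = 1 - ζ'`, so either `ζ = ζ' = 1` or
`x = (1 - ζ')/(ζ' - ζ) ∈ C`.  (2) `C ≠ Ω`: a cube root `x₀` of `2` does not lie in `C`, for
otherwise `x₀ ∈ ℚ(ζ_N)` for some `N`, an abelian extension of `ℚ`, so `ℚ(x₀)/ℚ` would be normal,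
hence would contain a primitive cube root of unity, and `2 = [ℚ(ζ₃):ℚ]` would divide
`3 = [ℚ(x₀):ℚ]`.  (3) For `c ∈ C`, `x₀ + c ∉ C`, so `σ` fixes `x₀ + c` and `x₀`, hence `c`.

This is the last step of an elementary proof of [Tpcs] Lemma 4.14 (S. Mochizuki, *Topics
surrounding the anabelian geometry of hyperbolic curves*, MSRI Publ. 41 (2003), Lemma 4.14 p. 48:
the absolute Galois group of a generalized sub-`p`-adic field is center-free), where Kummer theory
only yields `σ(x)/x ∈ ⋂_N (M^×)^N`, a torsion group for such fields.  Classical; Mathlib only.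
-/

noncomputable section

open Polynomial IntermediateField

namespace Literature.FieldTheory.Galois

universe u

variable {Ω : Type u} [Field Ω] [CharZero Ω] [IsAlgClosed Ω]

/-- `2` is not the cube of a rational number (`3 ∤ v₂(2) = 1`). [folklore] -/
private theorem Rat.pow_three_ne_two (b : ℚ) : b ^ 3 ≠ 2 := by
  intro hb
  have hb0 : b ≠ 0 := by
    rintro rfl
    norm_num at hb
  have h2 : padicValRat 2 (b ^ 3) = padicValRat 2 2 := by rw [hb]
  have h22 : padicValRat 2 (2 : ℚ) = 1 := by
    rw [show (2 : ℚ) = ((2 : ℕ) : ℚ) by norm_num, padicValRat.self one_lt_two]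
  rw [padicValRat.pow b (k := 3), h22] at h2
  omega

/-- `X³ - 2` is irreducible over `ℚ`. [folklore] -/
private theorem irreducible_X_pow_three_sub_two : Irreducible (X ^ 3 - C (2 : ℚ)) :=
  X_pow_sub_C_irreducible_of_prime Nat.prime_three fun b => Rat.pow_three_ne_two b

omit [IsAlgClosed Ω] in
/-- The field `ℚ(ζ) ⊆ Ω` generated by a primitive `n`-th root of unity is an `{n}`-cyclotomic
extension of `ℚ` (Mathlib's `IsPrimitiveRoot.intermediateField_adjoin_isCyclotomicExtension`
without the hypothesis that `Ω/ℚ` is algebraic). [folklore] -/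
private theorem isCyclotomicExtension_adjoin_of_isPrimitiveRoot {n : ℕ} [NeZero n] {ζ : Ω}
    (hζ : IsPrimitiveRoot ζ n) : IsCyclotomicExtension {n} ℚ ℚ⟮ζ⟯ := by
  have hint : IsIntegral ℚ ζ := (hζ.isIntegral (Nat.pos_of_ne_zero (NeZero.ne n))).tower_top
  change IsCyclotomicExtension {n} ℚ (ℚ⟮ζ⟯).toSubalgebra
  rw [IntermediateField.adjoin_simple_toSubalgebra_of_isAlgebraic hint.isAlgebraic]
  exact hζ.adjoin_isCyclotomicExtension ℚ

omit [IsAlgClosed Ω] in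
/-- `[ℚ(ω) : ℚ] = 2` for a primitive cube root of unity `ω`. [folklore] -/
private theorem finrank_adjoin_primitiveRoot_three {ω : Ω} (hω : IsPrimitiveRoot ω 3) :
    Module.finrank ℚ ℚ⟮ω⟯ = 2 := by
  haveI := isCyclotomicExtension_adjoin_of_isPrimitiveRoot hω
  rw [IsCyclotomicExtension.finrank (n := 3) ℚ⟮ω⟯
    (Polynomial.cyclotomic.irreducible_rat (by norm_num)), Nat.totient_prime Nat.prime_three]

omit [IsAlgClosed Ω] in
/-- `[ℚ(x₀) : ℚ] = 3` for a cube root `x₀` of `2`. [folklore] -/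
private theorem finrank_adjoin_cbrt_two {x₀ : Ω} (hx₀ : x₀ ^ 3 = 2) :
    Module.finrank ℚ ℚ⟮x₀⟯ = 3 := by
  have hmin : minpoly ℚ x₀ = X ^ 3 - C (2 : ℚ) := by
    refine (minpoly.eq_of_irreducible_of_monic irreducible_X_pow_three_sub_two ?_
      (monic_X_pow_sub_C _ (by norm_num))).symm
    simp [hx₀]
  have hint : IsIntegral ℚ x₀ := ⟨X ^ 3 - C 2, monic_X_pow_sub_C _ (by norm_num), by
    simp [hx₀]⟩
  rw [IntermediateField.adjoin.finrank hint, hmin, natDegree_X_pow_sub_C]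

/-- A cube root of `2` lies in no cyclotomic field `ℚ(ζ) ⊆ Ω`: cyclotomic fields are abelian over
`ℚ`, so `ℚ(x₀)` would be normal over `ℚ`, would contain a primitive cube root of unity `ω`, and
`2 = [ℚ(ω):ℚ]` would divide `3 = [ℚ(x₀):ℚ]`. [folklore] -/
private theorem cbrt_two_notMem_adjoin_primitiveRoot {x₀ : Ω} (hx₀ : x₀ ^ 3 = 2) {n : ℕ} [NeZero n]
    {ζ : Ω} (hζ : IsPrimitiveRoot ζ n) : x₀ ∉ ℚ⟮ζ⟯ := by
  intro hmem
  -- work inside the cyclotomic field `F = ℚ(ζ)`, an abelian extension of `ℚ`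
  haveI := isCyclotomicExtension_adjoin_of_isPrimitiveRoot hζ
  haveI : IsAbelianGalois ℚ ℚ⟮ζ⟯ := IsCyclotomicExtension.isAbelianGalois {n} ℚ ℚ⟮ζ⟯
  set z₀ : ℚ⟮ζ⟯ := ⟨x₀, hmem⟩ with hz₀def
  have hz₀ : z₀ ^ 3 = 2 := Subtype.ext (by push_cast [hz₀def]; exact hx₀)
  have hz0 : z₀ ≠ 0 := by
    intro h
    have : x₀ = 0 := by simpa [hz₀def] using congrArg Subtype.val h
    rw [this] at hx₀
    norm_num at hx₀
  -- `E = ℚ(z₀) ≤ ℚ(ζ)` is abelian, hence normal, over `ℚ`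
  set E : IntermediateField ℚ ℚ⟮ζ⟯ := ℚ⟮z₀⟯ with hE
  haveI : IsAbelianGalois ℚ E := IsAbelianGalois.tower_bot ℚ E ℚ⟮ζ⟯
  have hN : Normal ℚ E := inferInstance
  set x₀E : E := ⟨z₀, IntermediateField.mem_adjoin_simple_self ℚ z₀⟩ with hx₀E
  have hmin : minpoly ℚ x₀E = X ^ 3 - C (2 : ℚ) := by
    rw [show minpoly ℚ x₀E = minpoly ℚ z₀ from
      (minpoly.algebraMap_eq (algebraMap E ℚ⟮ζ⟯).injective x₀E).symm]
    refine (minpoly.eq_of_irreducible_of_monic irreducible_X_pow_three_sub_two ?_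
      (monic_X_pow_sub_C _ (by norm_num))).symm
    simp [hz₀]
  have hspl := hN.splits x₀E
  rw [hmin] at hspl
  -- transport the roots to `Ω` along `φ : E → ℚ(ζ) → Ω`
  set φ : E →+* Ω := (algebraMap ℚ⟮ζ⟯ Ω).comp (algebraMap E ℚ⟮ζ⟯) with hφ
  have hφz : φ x₀E = x₀ := rfl
  have hroots := hspl.roots_map φ
  rw [Polynomial.map_map, show φ.comp (algebraMap ℚ E) = algebraMap ℚ Ω from
    Subsingleton.elim _ _] at hroots
  -- a primitive cube root of unity `ω ∈ Ω`; the root `x₀ ω` of `X³ - 2` comes from `E`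
  obtain ⟨ω, hω⟩ := HasEnoughRootsOfUnity.exists_primitiveRoot Ω 3
  have hx0 : x₀ ≠ 0 := by
    rintro rfl
    norm_num at hx₀
  have hmem' : x₀ * ω ∈ ((X ^ 3 - C (2 : ℚ)).map (algebraMap ℚ Ω)).roots := by
    rw [mem_roots (by
      rw [Polynomial.map_sub, Polynomial.map_pow, map_X, map_C]
      exact X_pow_sub_C_ne_zero (by norm_num) _)]
    simp [mul_pow, hx₀, hω.pow_eq_one]
  rw [hroots, Multiset.mem_map] at hmem'
  obtain ⟨r, -, hr⟩ := hmem'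
  -- `w := r / x₀E ∈ E` maps to `ω`, so it is a primitive cube root of unity in `E`
  set w : E := r / x₀E with hw
  have hx₀E0 : x₀E ≠ 0 := fun h => hz0 (congrArg Subtype.val h)
  have hφw : φ w = ω := by
    rw [hw, map_div₀, hr, hφz, mul_div_cancel_left₀ _ hx0]
  have hwprim : IsPrimitiveRoot w 3 :=
    IsPrimitiveRoot.of_map_of_injective (by rw [hφw]; exact hω : IsPrimitiveRoot (φ w) 3)
      φ.injective
  have hwprim' : IsPrimitiveRoot (w : ℚ⟮ζ⟯) 3 :=
    hwprim.map_of_injective (algebraMap E ℚ⟮ζ⟯).injective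
  -- degrees: `2 = [ℚ(w):ℚ] ∣ [E:ℚ] = 3`
  have hle : ℚ⟮(w : ℚ⟮ζ⟯)⟯ ≤ E := IntermediateField.adjoin_simple_le_iff.mpr w.2
  have hdvd := IntermediateField.finrank_dvd_of_le_right hle
  rw [finrank_adjoin_primitiveRoot_three hwprim', hE, finrank_adjoin_cbrt_two hz₀] at hdvd
  omega

/-- The maximal cyclotomic subfield `ℚ(μ_∞) ⊆ Ω`: the intermediate field generated by all roots
of unity. (Local notation only; no new definition is introduced.) [folklore] -/
private theorem cbrt_two_notMem_adjoin_rootsOfUnity {x₀ : Ω} (hx₀ : x₀ ^ 3 = 2) :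
    x₀ ∉ IntermediateField.adjoin ℚ {ζ : Ω | ∃ n : ℕ, 0 < n ∧ ζ ^ n = 1} := by
  intro hmem
  obtain ⟨T, hTS, hxT⟩ := IntermediateField.exists_finset_of_mem_adjoin hmem
  classical
  -- a common order `N` for the finitely many roots of unity in `T`
  choose! ord hord using fun t (ht : t ∈ (T : Set Ω)) => hTS ht
  set N : ℕ := ∏ t ∈ T, ord t with hN
  have hNpos : 0 < N := Finset.prod_pos fun t ht => (hord t ht).1
  haveI : NeZero N := ⟨hNpos.ne'⟩
  obtain ⟨ζ, hζ⟩ := HasEnoughRootsOfUnity.exists_primitiveRoot Ω N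
  have hTle : IntermediateField.adjoin ℚ (T : Set Ω) ≤ ℚ⟮ζ⟯ := by
    rw [IntermediateField.adjoin_le_iff]
    intro t ht
    have htN : t ^ N = 1 := by
      obtain ⟨k, hk⟩ := Finset.dvd_prod_of_mem ord ht
      rw [hN, hk, pow_mul, (hord t ht).2, one_pow]
    obtain ⟨i, -, hi⟩ := hζ.eq_pow_of_pow_eq_one htN
    rw [← hi]
    exact pow_mem (IntermediateField.mem_adjoin_simple_self ℚ ζ) i
  exact cbrt_two_notMem_adjoin_primitiveRoot hx₀ hζ (hTle hxT)

/-- **An endomorphism twisting every nonzero element by a root of unity is the identity.**  If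
`σ : Ω →+* Ω` (with `Ω` algebraically closed of characteristic `0`) satisfies: for every `x ≠ 0`
there is `n ≥ 1` with `σ(x)ⁿ = xⁿ`, then `σ x = x` for all `x`.  (The closing step of the
elementary proof of [Tpcs] Lemma 4.14.) [cite: MochizukiTopics2003, Lem 4.14 p.48] -/
theorem eq_self_of_forall_pow_eq (σ : Ω →+* Ω)
    (h : ∀ x : Ω, x ≠ 0 → ∃ n : ℕ, 0 < n ∧ σ x ^ n = x ^ n) (x : Ω) : σ x = x := by
  classical
  set C : IntermediateField ℚ Ω :=
    IntermediateField.adjoin ℚ {ζ : Ω | ∃ n : ℕ, 0 < n ∧ ζ ^ n = 1} with hC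
  -- the twisting factor `σ y / y` is a root of unity, hence lies in `C`
  have hquot : ∀ y : Ω, y ≠ 0 → σ y / y ∈ C := by
    intro y hy
    obtain ⟨n, hn, hσ⟩ := h y hy
    refine IntermediateField.subset_adjoin ℚ _ ⟨n, hn, ?_⟩
    rw [div_pow, hσ, div_self (pow_ne_zero _ hy)]
  -- (1) `σ` fixes every element outside `C`
  have hfix : ∀ y : Ω, y ∉ C → σ y = y := by
    intro y hyC
    have hy0 : y ≠ 0 := by
      rintro rfl
      exact hyC (zero_mem C)
    have hy1 : 1 + y ≠ 0 := by
      intro h1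
      apply hyC
      have : y = -1 := by linear_combination h1
      rw [this]
      exact neg_mem (one_mem C)
    obtain ⟨ζ, hζC, hσy⟩ : ∃ ζ ∈ C, σ y = ζ * y :=
      ⟨σ y / y, hquot y hy0, by rw [div_mul_cancel₀ _ hy0]⟩
    obtain ⟨ζ', hζ'C, hσy'⟩ : ∃ ζ' ∈ C, σ (1 + y) = ζ' * (1 + y) :=
      ⟨σ (1 + y) / (1 + y), hquot (1 + y) hy1, by rw [div_mul_cancel₀ _ hy1]⟩
    have hkey : (ζ' - ζ) * y = 1 - ζ' := by
      have : σ (1 + y) = 1 + σ y := by rw [map_add, map_one]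
      rw [hσy', hσy] at this
      linear_combination this
    by_cases hζζ : ζ' = ζ
    · -- then `ζ' = 1 = ζ`
      rw [hζζ, sub_self, zero_mul] at hkey
      have hζ1 : ζ = 1 := by linear_combination hkey
      rw [hσy, hζ1, one_mul]
    · exfalso
      apply hyC
      have : y = (1 - ζ') / (ζ' - ζ) := by
        rw [eq_div_iff (sub_ne_zero.mpr hζζ)]
        linear_combination hkey
      rw [this]
      exact div_mem (sub_mem (one_mem C) hζ'C) (sub_mem hζ'C hζC)
  -- (2) an element outside `C`: a cube root of `2`
  obtain ⟨x₀, hx₀⟩ := IsAlgClosed.exists_pow_nat_eq (2 : Ω) (by norm_num : 0 < 3)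
  have hx₀C : x₀ ∉ C := cbrt_two_notMem_adjoin_rootsOfUnity hx₀
  -- (3) conclude
  by_cases hxC : x ∈ C
  · have h1 : σ (x₀ + x) = x₀ + x := by
      refine hfix _ fun hmem => hx₀C ?_
      have : x₀ = (x₀ + x) - x := by ring
      rw [this]
      exact sub_mem hmem hxC
    have h2 : σ x₀ = x₀ := hfix x₀ hx₀C
    have : σ (x₀ + x) = σ x₀ + σ x := map_add σ x₀ x
    rw [h1, h2] at this
    linear_combination -this
  · exact hfix x hxC

end Literature.FieldTheory.Galois
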